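import Summits.ResolutionOfSingularities.ResolutionOfSingularities.Theorems.FrobeniusClosingPatchingRelPerfectCentreSeqExtendOpen
import Summits.ResolutionOfSingularities.ResolutionOfSingularities.Theorems.FrobeniusClosingPatchingRelPerfectMonomialSumPairs
import Literature.AlgebraicGeometry.Resolution.MarkedIdealsLemmas
import HarnessLib

/-!
# Crux `PatchingRelPerfect` (stmt-ResolutionOfSingularities-16161), chain W5.2 — TargetsF5 T5-M:
# the monomial PAIR game with the snc boundary only on an open `U ⊇ cosupp` (content)

[OURS · L1 W5.2 · rung tool] res-L1-w52-plan-1 F5-DESIGN-MEMO §3′/§5 and `ChainW52TargetsF5.lean` S-TARGET T5-M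
`LocalPairGame`: at the END of the mixed engine of rung R4ˢ-general the X-side ideal is a SUM OF TWO MONOMIALS in a
family that is simple normal crossings only on an open `U ⊇ cosupp` (the member's strict transform is singular far
from `E'`), so res-L1-w52-stub-4's pair game `monomialSumPrincipalization_of_length_le_two` (p504028, snc on the whole
scheme) has to be run on `U` and EXTENDED (`CentreSeqExtend.exists_centreSeq_of_open`, p509147).  PROVED:

* `comap_monomialIdeal_eq_map`, `comap_monomialSum_eq_map`, `boundaryOf_map_comap` — monomial ideals / sums pull back
  along ANY morphism to the monomial ideals / sums of the pulled-back exponent lists (`comap_mul`, `comap_pow`);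
* **`monomialSumPrincipalization_local_pair`** — `X`, `U` Noetherian, `X` regular, `j : U ⟶ X` an open immersion,
  `Es` ideal sheaves of `X` with `HasSNC (Es.map (·|_U))`, `𝒦` one or two exponent lists on `Es` with
  `cosupp (monomialSum 𝒦) ⊆ j(U)` ⇒ a multiple blow-up of `X` with regular centres over the cosupport, regular top,
  principalizing `monomialSum 𝒦`.

The by-name closure of `DepthTargets.LocalPairGame` is a one-liner over this file once the F5 definitions land.
Fact-free; nothing here is a statement of the manuscript under review.

## References

* J. Kollár, *Lectures on Resolution of Singularities* (2007), (3.111) Step 3. [Kollar2007]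
* U. Görtz, T. Wedhorn, *Algebraic Geometry I*, 2nd ed. (2020), Prop. 13.91 (1)–(2). [GortzWedhorn2020]
* E. Bierstone, D. Grigoriev, P. Milman, J. Włodarczyk (2011), Def. 3.1.5 Remark (1), §4 Step 2b.
  [BierstoneGrigorievMilmanWlodarczyk2011]
-/

-- `Summit.<Summit>.<Sub>.Theorems` with `Sub = Summit` (single-conjunct summit, D-0017)
set_option linter.dupNamespace false

noncomputable section

open CategoryTheory CategoryTheory.Limits AlgebraicGeometry TopologicalSpace
open Literature.AlgebraicGeometry.Resolution

namespace Summit.ResolutionOfSingularities.ResolutionOfSingularities.Theorems.DepthTargets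

open CentreSeqExtend

universe v

variable {X Y : Scheme.{v}}

/-! ## §1 Monomial sums along a morphism -/

/-- Inverse image of a monomial ideal: `f⁻¹(∏ D_k^{a_k})𝒪 = ∏ (f⁻¹D_k 𝒪)^{a_k}`. [folklore] -/
theorem comap_monomialIdeal_eq_map (A : List (Y.IdealSheafData × ℕ)) (f : X ⟶ Y) :
    (monomialIdeal A).comap f = monomialIdeal (A.map fun p => (p.1.comap f, p.2)) := by
  induction A with
  | nil => rw [List.map_nil, monomialIdeal_nil, monomialIdeal_nil, Scheme.IdealSheafData.comap_top]
  | cons p A ih => rw [List.map_cons, monomialIdeal_cons, monomialIdeal_cons, comap_mul, comap_pow, ih]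

/-- The boundary of the pulled-back exponent list is the pulled-back boundary. [folklore] -/
theorem boundaryOf_map_comap (A : List (Y.IdealSheafData × ℕ)) (f : X ⟶ Y) :
    boundaryOf (A.map fun p => (p.1.comap f, p.2)) = (boundaryOf A).map (·.comap f) := by
  simp only [boundaryOf, List.map_map]
  rfl

/-- Inverse image of a monomial sum. [folklore] -/
theorem comap_monomialSum_eq_map (𝒦 : List (List (Y.IdealSheafData × ℕ))) (f : X ⟶ Y) :
    (monomialSum 𝒦).comap f = monomialSum (𝒦.map fun A => A.map fun p => (p.1.comap f, p.2)) := by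
  induction 𝒦 with
  | nil => rw [List.map_nil, monomialSum_nil, monomialSum_nil, Scheme.IdealSheafData.comap_bot]
  | cons A 𝒦 ih =>
    rw [List.map_cons, monomialSum_cons, monomialSum_cons, Scheme.IdealSheafData.comap_sup,
      comap_monomialIdeal_eq_map, ih]

/-! ## §2 T5-M: the pair game with the snc boundary only on an open `U ⊇ cosupp` -/

/-- **T5-M `MonomialSumPrincipalizationLocalPair` (content)** — res-L1-w52-plan-1 F5-DESIGN-MEMO §3′/§5: the
monomial-pair game of res-L1-w52-stub-4 (`monomialSumPrincipalization_of_length_le_two`, p504028) LOCALISED. Let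
`X` be a regular Noetherian scheme, `j : U ⟶ X` an open immersion from a Noetherian scheme, `Es` a list of ideal
sheaves of `X` whose restrictions to `U` form an snc boundary (`HasSNC (Es.map (·|_U))`), and `𝒦` one or two
exponent lists on `Es` whose monomial SUM is cosupported inside `j(U)`.  Then there is a multiple blow-up of `X`
with regular centres over `cosupp (monomialSum 𝒦)`, regular top, along which `monomialSum 𝒦` becomes locally
principal: run the pair game on `U` (its centres lie over the cosupport, which is CLOSED IN `X`) and extend it
(`CentreSeqExtend.exists_centreSeq_of_open`). Fact-free; NOT a statement of the manuscript under review.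
[cite: GortzWedhorn2020, Prop. 13.91 (1)–(2)] [cite: BierstoneGrigorievMilmanWlodarczyk2011, Def. 3.1.5 Remark (1)] -/
theorem monomialSumPrincipalization_local_pair {X U : Scheme.{v}} [IsNoetherian X] [IsNoetherian U]
    (hX : Scheme.IsRegular X) (j : U ⟶ X) [IsOpenImmersion j] (Es : List X.IdealSheafData)
    (hEs : HasSNC (Es.map (·.comap j))) (𝒦 : List (List (X.IdealSheafData × ℕ)))
    (h𝒦 : ∀ K ∈ 𝒦, boundaryOf K = Es) (hne : 𝒦 ≠ []) (hlen : 𝒦.length ≤ 2)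
    (hsupp : ((monomialSum 𝒦).support : Set X) ⊆ Set.range j.base) :
    ∃ s : CentreSeq X, s.AllRegular ∧ s.CentresOver ((monomialSum 𝒦).support : Set X) ∧
      Scheme.IsRegular s.top ∧ IsLocallyPrincipal ((monomialSum 𝒦).comap s.comp) := by
  -- the pulled-back family on `U`
  set 𝒦' : List (List (U.IdealSheafData × ℕ)) := 𝒦.map fun A => A.map fun p => (p.1.comap j, p.2)
    with h𝒦'
  have hsum : (monomialSum 𝒦).comap j = monomialSum 𝒦' := comap_monomialSum_eq_map 𝒦 j
  have h𝒦'b : ∀ K ∈ 𝒦', boundaryOf K = Es.map (·.comap j) := by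
    intro K hK
    obtain ⟨A, hA, rfl⟩ := List.mem_map.mp hK
    rw [boundaryOf_map_comap, h𝒦 A hA]
  have hne' : 𝒦' ≠ [] := by
    rw [h𝒦']
    exact fun h => hne (List.map_eq_nil_iff.mp h)
  have hlen' : 𝒦'.length ≤ 2 := by rw [h𝒦', List.length_map]; exact hlen
  -- the pair game on `U`
  obtain ⟨s, hreg, hover, -, hlp⟩ := monomialSumPrincipalization_of_length_le_two U
    (Scheme.IsRegular.of_isOpenImmersion j hX) (Es.map (·.comap j)) hEs 𝒦' h𝒦'b hne' hlen'
  -- its centres lie over `j⁻¹ cosupp`, a set CLOSED IN `X`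
  have hover' : s.CentresOver (j.base ⁻¹' ((monomialSum 𝒦).support : Set X)) := by
    have h : ((monomialSum 𝒦').support : Set U) = j.base ⁻¹' ((monomialSum 𝒦).support : Set X) := by
      rw [← hsum, Scheme.IdealSheafData.support_comap]
      rfl
    rw [← h]
    exact hover
  -- extend to `X`
  obtain ⟨t, htreg, htover, httop, htlp⟩ := exists_centreSeq_of_open hX j (monomialSum 𝒦).support.isClosed
    hsupp s hreg hover'
  exact ⟨t, htreg, htover, httop, htlp (monomialSum 𝒦) le_rfl (by rw [hsum]; exact hlp)⟩

end Summit.ResolutionOfSingularities.ResolutionOfSingularities.Theorems.DepthTargets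

end
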